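import Literature.NumberTheory.K2Lit.DoubledLineThetaKernel
import Literature.NumberTheory.Automorphic.Liu2021.ThetaLiftFromLineContinuity
import Literature.NumberTheory.K2Lit.DoublingZetaIntegral
import Literature.NumberTheory.K2Lit.DoublingEmbedding
import Summits.HodgeConjecture.HodgeConjecture.Theorems.K2LiuDoublingPairingContinuous
import Summits.HodgeConjecture.HodgeConjecture.Theorems.K2LiuThetaKernelSliceIntegral
import Summits.HodgeConjecture.HodgeConjecture.Theorems.K2LiuDoubledLineThetaAutomorphic
import Summits.HodgeConjecture.HodgeConjecture.Theorems.K2LiuDoublingUnfoldOrbit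
import HarnessLib

/-!
# Continuity in `Φ` of the doubling pairing of the pulled-back doubled theta integral — organ (O45)(i) of socket #44∕45, theta half

Track B ∕ hLiu418 = stmt-HodgeConjecture-24832, line `K2_Liu_CurveThetaSigs`, unit U6 (ED. 4, the s5 seam), socket #44∕45 `sig_K2LiuUndoublingSeparation`,
organ (O45) part (i) «continuity of `Φ ↦ pairing`» (LEAD F0P6-plan GO 2026-09-03 23:34Z; statement in the seat's words); seat `hodgecm-mathlib-K2Liu-p03` (g2).
THETA HALF, completing ★ `K2LiuDoublingPairingContinuous.continuousAt_doublingPairing_of_uniform` (the abstract half): for the hypothesis kernel of #44∕45,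
`F Φ := toQuotFun₂ ((g₁, g₂) ↦ I(ι(ιA g₁, ιA g₂); Φ, μW))` (★ D8 `doubledLineThetaIntegral`, ★ D3 `iotaV`, ★ D4 `toQuotFun₂`), with `ιA` CONTINUOUS and carrying
rational points to rational points (ED. 4 binders F-44a `hιAc`, `hιAr`), `[G]` compact, `μW` a finite Borel measure on the compact `[U(⟨a′⟩)]`:

Generic inputs: ★ `Theorems/K2LiuThetaKernelSliceIntegral` (continuity ∕ bounds ∕ uniform convergence in `Φ` of the weighted slice integrals
`p ↦ ∫ f(q) θ_Φ(p, q) dν(q)` of ANY theta-kernel datum with compact second quotient — the first quotient `[U(𝔻)]` is NOT compact, so ★ `thetaLift` is not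
available — and the descent of invariant continuous maps through `Quotient.out`).
* §3 (the socket's data, `N`, `dW` general with `M = 1`): the point map `x ↦ [ (toDiagA ι(ιA x̃₁⁻¹, ιA x̃₂⁻¹))⁻¹ ]` is continuous on `[G]²`
  (`continuous_doubledThetaPoint`; invariance by ★ `iotaLeft_toAdelic_mem_ratH`, ★ `diagG_rational`, ★ `toDiagA_mem_range_toAdelic`); hence `F Φ` is continuous
  (`continuous_toQuotFun₂_doubledLineThetaLift`), uniformly convergent along every linear family `Λ : E → 𝒮(𝔸^{n″})` from a barrelled space with
  continuous theta slots (`toQuotFun₂_doubledLineThetaLift_uniform_of_slot` — the tree's form of Weil's Théorème 6 in `Φ`, ★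
  `ThetaLiftFromLineContinuity`), hence **`e ↦ doublingPairing μ (F (Λ e)) w₁ w₂` is continuous** for integrable `w₁, w₂`
  (`continuous_doublingPairing_doubledLineThetaLift_of_slot`), in particular **on the Schwartz space of the archimedean slot, `φ ↦ φ ⊗ Φ_f`**
  (`continuous_doublingPairing_doubledLineThetaIntegral_tmul` — literally the hypothesis kernel of #44∕45).

No definition, no instance, no named fact; axioms ⊆ {propext, Classical.choice, Quot.sound}.

## References
* M. Harris, S. Kudla, W. J. Sweet, *Theta dichotomy for unitary groups*, J. AMS 9 (1996), §1 proof of Lem. 1.1 [HarrisKudlaSweet1996].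
* A. Weil, *Sur certains groupes d'opérateurs unitaires*, Acta Math. 111 (1964), Chap. III n° 39–41 [Weil1964].
* Y. Liu, *Fourier–Jacobi cycles and arithmetic relative trace formula*, Invent. Math. (2021), App. B (B.7) [Liu2021].

HONEST LABEL: HC_CM is proved only modulo the 7 printed citations (2 remaining named inputs: hLiu418 =
stmt-HodgeConjecture-24832, h413 = stmt-HodgeConjecture-24833) until rung 0 closes; this helper moves no counter.
-/

noncomputable section

set_option autoImplicit false

set_option linter.dupNamespace false

open NumberField MeasureTheory IsDedekindDomain Filter Set
open scoped Matrix Topology SchwartzMap TensorProduct Classical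

namespace Summit.HodgeConjecture.HodgeConjecture.Cruxes.HLiu418.K2LiuDoubledThetaPairingContinuous

open Literature.NumberTheory.Automorphic Literature.NumberTheory.Automorphic.UnitaryGroup
open Literature.NumberTheory.Automorphic.IdeleClassGroup
open Literature.NumberTheory.Automorphic.Liu2021
open Literature.NumberTheory.Automorphic.Liu2021.Def411WeilCarriers
open Literature.NumberTheory.Automorphic.Liu2021.Def411WeilCarriersDoubling
open Literature.NumberTheory.GelbartRogawski1991 Literature.NumberTheory.GelbartRogawski1991.UnitaryDualPair
open Literature.NumberTheory.GelbartRogawski1991.GRConstruction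
open Literature.NumberTheory.Weil1964
open Literature.RepresentationTheory.Liu2021
open Literature.RepresentationTheory.CompactGroups
open Literature.RepresentationTheory.HeisenbergGroup
open Literature.NumberTheory.K2Lit.DoubledLineTheta Literature.NumberTheory.K2Lit.SiegelDoubled
open Summit.HodgeConjecture.HodgeConjecture.Cruxes.HLiu418.K2LiuDoublingPairingContinuous
open Summit.HodgeConjecture.HodgeConjecture.Cruxes.HLiu418.K2LiuThetaKernelSliceIntegral
open Summit.HodgeConjecture.HodgeConjecture.Cruxes.HLiu418.K2LiuDoubledLineThetaAutomorphic
open Summit.HodgeConjecture.HodgeConjecture.Cruxes.HLiu418.K2LiuDoublingUnfoldOrbit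

/-! ## §3 The socket's kernel: continuity on `[G]²`, uniform convergence in `Φ`, continuity of the pairing -/

section Socket

variable (L : Type) [Field L] [NumberField L] [IsCMField L]
variable {N n : ℕ} (e : Fin N × Fin 1 ≃ Fin n) (H : Matrix (Fin N) (Fin N) L)
  (dV : Fin N → L) (hdV : ∀ i, IsCMField.complexConj L (dV i) = dV i)
  (dW : Fin 1 → L) (hdW : ∀ i, IsCMField.complexConj L (dW i) = dW i)
  {n'' : ℕ} (e₁ : Fin (n + n) × Fin 1 ≃ Fin n'')
  (hdV0 : ∀ i, dV i ≠ 0) (hdW0 : ∀ i, dW i ≠ 0)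
  (lam : IdeleClassGroup L →ₜ* Circle) (hlam : IsConjugateSymplectic L lam) (a' : (Fp L)ˣ)
  (hρ : HasThetaMajorants fun
      (p : ↥(UnitaryGroup.adelic (Fp L) L (IsCMField.complexConj L) (n + n) (Matrix.diagonal (dD L e dV hdV dW hdW))) ×
        ↥(UnitaryGroup.adelic (Fp L) L (IsCMField.complexConj L) 1 (JW (Fp L) L a')))
      (Φ : piSchwartzBruhat (Fp L) (Fin n'')) =>
        pairRep (Fp L) L (IsCMField.complexConj L) (n + n) 1 e₁ (Matrix.diagonal (dD L e dV hdV dW hdW)) (JW (Fp L) L a')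
          (chiSplittingLine L e₁ (dD L e dV hdV dW hdW) (dD_conj L e dV hdV dW hdW) (dD_ne_zero L e dV hdV dW hdW hdV0 hdW0)
            (toHeckeCharacter L lam) (isUnitary_toHeckeCharacter L lam)
            ((isOscillatorChar_toHeckeCharacter_iff lam).mpr hlam) (TW (Fp L) a')
            (isUnit_det_TW (Fp L) a') (JW (Fp L) L a') (JW_eq (Fp L) L a'))
          p Φ)
  (ιA : (adelicGroupData (Fp L) L (IsCMField.complexConj L) N H).Adelic →*
    ↥(UnitaryGroup.adelic (Fp L) L (IsCMField.complexConj L) N (Matrix.diagonal dV)))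
  (hιAc : Continuous ιA)
  (hιAr : ∀ ⦃γ : (adelicGroupData (Fp L) L (IsCMField.complexConj L) N H).Adelic⦄,
    γ ∈ (UnitaryGroup.toAdelic (Fp L) L (IsCMField.complexConj L) N H).range →
      ιA γ ∈ (UnitaryGroup.toAdelic (Fp L) L (IsCMField.complexConj L) N (Matrix.diagonal dV)).range)
  [MeasurableSpace (↥(UnitaryGroup.adelic (Fp L) L (IsCMField.complexConj L) 1 (JW (Fp L) L a')) ⧸
    (UnitaryGroup.toAdelic (Fp L) L (IsCMField.complexConj L) 1 (JW (Fp L) L a')).range)]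
  [BorelSpace (↥(UnitaryGroup.adelic (Fp L) L (IsCMField.complexConj L) 1 (JW (Fp L) L a')) ⧸
    (UnitaryGroup.toAdelic (Fp L) L (IsCMField.complexConj L) 1 (JW (Fp L) L a')).range)]
  (μW : Measure (↥(UnitaryGroup.adelic (Fp L) L (IsCMField.complexConj L) 1 (JW (Fp L) L a')) ⧸
    (UnitaryGroup.toAdelic (Fp L) L (IsCMField.complexConj L) 1 (JW (Fp L) L a')).range)) [IsFiniteMeasure μW]
  (f : C(↥(UnitaryGroup.adelic (Fp L) L (IsCMField.complexConj L) 1 (JW (Fp L) L a')) ⧸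
    (UnitaryGroup.toAdelic (Fp L) L (IsCMField.complexConj L) 1 (JW (Fp L) L a')).range, ℂ))

include hιAr in
/-- **`ι(ιA γ, 1) ∈ H(L⁺)` and `ι(1, ιA γ) ∈ H(L⁺)` for `γ ∈ A_G G(L⁺) = G(L⁺)`** (`ιA γ = a₀,𝔸` is rational by `hιAr`; ★ `iotaLeft_toAdelic_mem_ratH`,
and `ι(1, a) = ι(a, a) · ι(a⁻¹, 1)` with ★ `iotaV_diag`, ★ `diagG_rational`, ★ `adelicInl_toAdelic_mem_range`). [cite: Liu2021, §B.3 p. 101] -/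
theorem iotaV_iotaA_mem_ratH {γ : (adelicGroupData (Fp L) L (IsCMField.complexConj L) N H).Adelic}
    (hγ : γ ∈ (adelicGroupData (Fp L) L (IsCMField.complexConj L) N H).quotientSubgroup) :
    iotaV L e dV hdV dW hdW (ιA γ, 1) ∈ ratH L e dV hdV dW hdW ∧ iotaV L e dV hdV dW hdW (1, ιA γ) ∈ ratH L e dV hdV dW hdW := by
  have hγ' : γ ∈ (UnitaryGroup.toAdelic (Fp L) L (IsCMField.complexConj L) N H).range := by
    have h' : γ ∈ (⊥ : Subgroup (adelicGroupData (Fp L) L (IsCMField.complexConj L) N H).Adelic) ⊔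
        (UnitaryGroup.toAdelic (Fp L) L (IsCMField.complexConj L) N H).range := hγ
    rwa [bot_sup_eq] at h'
  obtain ⟨a₀, ha₀⟩ := MonoidHom.mem_range.mp (hιAr hγ')
  have hleft : ∀ b₀ : UnitaryGroup.rational (Fp L) L (IsCMField.complexConj L) N (Matrix.diagonal dV),
      iotaV L e dV hdV dW hdW (UnitaryGroup.toAdelic (Fp L) L (IsCMField.complexConj L) N (Matrix.diagonal dV) b₀, 1) ∈
        ratH L e dV hdV dW hdW := fun b₀ => by
    have h := iotaLeft_toAdelic_mem_ratH L e dV hdV dW hdW b₀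
    rwa [iotaLeft_apply] at h
  refine ⟨?_, ?_⟩
  · rw [← ha₀]
    exact hleft a₀
  · have hsplit : ((1 : ↥(UnitaryGroup.adelic (Fp L) L (IsCMField.complexConj L) N (Matrix.diagonal dV))), ιA γ) =
        (ιA γ, ιA γ) * ((ιA γ)⁻¹, 1) := by
      ext <;> simp
    rw [hsplit, map_mul]
    refine Subgroup.mul_mem _ ?_ ?_
    · rw [iotaV_diag]
      refine diagG_rational L e dV hdV dW hdW _ ?_
      rw [← ha₀]
      exact UnitaryGroup.adelicInl_toAdelic_mem_range (Fp L) L (IsCMField.complexConj L) N 1 (Matrix.diagonal dV)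
        (Matrix.diagonal dW) a₀
    · rw [← ha₀, ← map_inv]
      exact hleft a₀⁻¹

include hιAc hιAr in
/-- **The point map of the socket's kernel is continuous on `[G]²`**: `x ↦ [(toDiagA ι(ιA x̃₁⁻¹, ιA x̃₂⁻¹))⁻¹] ∈ [U(diag d^𝔻)]`, `x̃ᵢ = out xᵢ`, is the
descent of the continuous right-`G(L⁺)²`-invariant map `(g₁, g₂) ↦ [(toDiagA ι(ιA g₁⁻¹, ιA g₂⁻¹))⁻¹]` (invariance: `iotaV_iotaA_mem_ratH`, ★
`toDiagA_mem_range_toAdelic`, `QuotientGroup.mk_mul_of_mem`). [cite: Liu2021, §B.3 (B.7) p. 101] -/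
theorem continuous_doubledThetaPoint :
    Continuous fun x : (adelicGroupData (Fp L) L (IsCMField.complexConj L) N H).automorphicQuotient ×
        (adelicGroupData (Fp L) L (IsCMField.complexConj L) N H).automorphicQuotient =>
      (QuotientGroup.mk (toDiagA L e dV hdV dW hdW (iotaV L e dV hdV dW hdW
          (ιA ((Quotient.out (x.1 : (adelicGroupData (Fp L) L (IsCMField.complexConj L) N H).Adelic ⧸
              (adelicGroupData (Fp L) L (IsCMField.complexConj L) N H).quotientSubgroup)) :
              (adelicGroupData (Fp L) L (IsCMField.complexConj L) N H).Adelic)⁻¹,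
           ιA ((Quotient.out (x.2 : (adelicGroupData (Fp L) L (IsCMField.complexConj L) N H).Adelic ⧸
              (adelicGroupData (Fp L) L (IsCMField.complexConj L) N H).quotientSubgroup)) :
              (adelicGroupData (Fp L) L (IsCMField.complexConj L) N H).Adelic)⁻¹)))⁻¹ :
        ↥(UnitaryGroup.adelic (Fp L) L (IsCMField.complexConj L) (n + n) (Matrix.diagonal (dD L e dV hdV dW hdW))) ⧸
          (UnitaryGroup.toAdelic (Fp L) L (IsCMField.complexConj L) (n + n) (Matrix.diagonal (dD L e dV hdV dW hdW))).range) := by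
  refine continuous_out_of_invariant₂ (adelicGroupData (Fp L) L (IsCMField.complexConj L) N H)
    (fun g => (QuotientGroup.mk (toDiagA L e dV hdV dW hdW (iotaV L e dV hdV dW hdW (ιA g.1⁻¹, ιA g.2⁻¹)))⁻¹ :
        ↥(UnitaryGroup.adelic (Fp L) L (IsCMField.complexConj L) (n + n) (Matrix.diagonal (dD L e dV hdV dW hdW))) ⧸
          (UnitaryGroup.toAdelic (Fp L) L (IsCMField.complexConj L) (n + n) (Matrix.diagonal (dD L e dV hdV dW hdW))).range))
    ?_ ?_ ?_
  · exact continuous_quotient_mk'.comp (((continuous_toDiagA L e dV hdV dW hdW).comp ((continuous_iotaV L e dV hdV dW hdW).comp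
      ((hιAc.comp continuous_fst.inv).prodMk (hιAc.comp continuous_snd.inv)))).inv)
  · intro γ hγ g₁ g₂
    have hmem := (iotaV_iotaA_mem_ratH L e H dV hdV dW hdW ιA hιAr (inv_mem hγ)).1
    have hsplit : (ιA (g₁ * γ)⁻¹, ιA g₂⁻¹) = (ιA γ⁻¹, (1 : ↥(UnitaryGroup.adelic (Fp L) L (IsCMField.complexConj L) N (Matrix.diagonal dV)))) *
        (ιA g₁⁻¹, ιA g₂⁻¹) := by
      ext <;> simp [mul_inv_rev]
    show (QuotientGroup.mk (toDiagA L e dV hdV dW hdW (iotaV L e dV hdV dW hdW (ιA (g₁ * γ)⁻¹, ιA g₂⁻¹)))⁻¹ : _ ⧸ _) =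
      QuotientGroup.mk (toDiagA L e dV hdV dW hdW (iotaV L e dV hdV dW hdW (ιA g₁⁻¹, ιA g₂⁻¹)))⁻¹
    rw [hsplit, map_mul, map_mul, mul_inv_rev]
    exact QuotientGroup.mk_mul_of_mem _ (inv_mem (toDiagA_mem_range_toAdelic L e dV hdV dW hdW ⟨_, hmem⟩))
  · intro γ hγ g₁ g₂
    have hmem := (iotaV_iotaA_mem_ratH L e H dV hdV dW hdW ιA hιAr (inv_mem hγ)).2
    have hsplit : (ιA g₁⁻¹, ιA (g₂ * γ)⁻¹) = ((1 : ↥(UnitaryGroup.adelic (Fp L) L (IsCMField.complexConj L) N (Matrix.diagonal dV))), ιA γ⁻¹) *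
        (ιA g₁⁻¹, ιA g₂⁻¹) := by
      ext <;> simp [mul_inv_rev]
    show (QuotientGroup.mk (toDiagA L e dV hdV dW hdW (iotaV L e dV hdV dW hdW (ιA g₁⁻¹, ιA (g₂ * γ)⁻¹)))⁻¹ : _ ⧸ _) =
      QuotientGroup.mk (toDiagA L e dV hdV dW hdW (iotaV L e dV hdV dW hdW (ιA g₁⁻¹, ιA g₂⁻¹)))⁻¹
    rw [hsplit, map_mul, map_mul, mul_inv_rev]
    exact QuotientGroup.mk_mul_of_mem _ (inv_mem (toDiagA_mem_range_toAdelic L e dV hdV dW hdW ⟨_, hmem⟩))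

omit [BorelSpace (↥(UnitaryGroup.adelic (Fp L) L (IsCMField.complexConj L) 1 (JW (Fp L) L a')) ⧸
    (UnitaryGroup.toAdelic (Fp L) L (IsCMField.complexConj L) 1 (JW (Fp L) L a')).range)] [IsFiniteMeasure μW] in
/-- **The socket's kernel in closed form** (definitional): `toQuotFun₂ (g ↦ Θ̃_Φ(f)(ι(ιA g₁, ιA g₂))) x = ∫ f(q) θ_Φ(P(x), q) dμW(q)` with `P` the point map of
`continuous_doubledThetaPoint`. [cite: Liu2021, App. B (B.7) p. 104] -/
theorem toQuotFun₂_doubledLineThetaLift_apply (Φ : piSchwartzBruhat (Fp L) (Fin n''))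
    (x : (adelicGroupData (Fp L) L (IsCMField.complexConj L) N H).automorphicQuotient ×
      (adelicGroupData (Fp L) L (IsCMField.complexConj L) N H).automorphicQuotient) :
    toQuotFun₂ (adelicGroupData (Fp L) L (IsCMField.complexConj L) N H)
        (fun g => doubledLineThetaLift L e dV hdV dW hdW e₁ hdV0 hdW0 lam hlam a' hρ μW Φ f (iotaV L e dV hdV dW hdW (ιA g.1, ιA g.2))) x =
      ∫ q, f q * (lineThetaKernelDatum L (n + n) e₁ (dD L e dV hdV dW hdW) (dD_conj L e dV hdV dW hdW)
          (dD_ne_zero L e dV hdV dW hdW hdV0 hdW0) lam hlam a' hρ).thetaKer Φ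
        ((QuotientGroup.mk (toDiagA L e dV hdV dW hdW (iotaV L e dV hdV dW hdW
          (ιA ((Quotient.out (x.1 : (adelicGroupData (Fp L) L (IsCMField.complexConj L) N H).Adelic ⧸
              (adelicGroupData (Fp L) L (IsCMField.complexConj L) N H).quotientSubgroup)) :
              (adelicGroupData (Fp L) L (IsCMField.complexConj L) N H).Adelic)⁻¹,
           ιA ((Quotient.out (x.2 : (adelicGroupData (Fp L) L (IsCMField.complexConj L) N H).Adelic ⧸
              (adelicGroupData (Fp L) L (IsCMField.complexConj L) N H).quotientSubgroup)) :
              (adelicGroupData (Fp L) L (IsCMField.complexConj L) N H).Adelic)⁻¹)))⁻¹ :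
        ↥(UnitaryGroup.adelic (Fp L) L (IsCMField.complexConj L) (n + n) (Matrix.diagonal (dD L e dV hdV dW hdW))) ⧸
          (UnitaryGroup.toAdelic (Fp L) L (IsCMField.complexConj L) (n + n) (Matrix.diagonal (dD L e dV hdV dW hdW))).range), q) ∂μW :=
  rfl

include hιAc hιAr in
/-- **The socket's kernel is continuous on `[G]²`** (§1 `continuous_integral_thetaKer` along `continuous_doubledThetaPoint`). [cite: Liu2021, App. B (B.7) p. 104]
[cite: Weil1964, Chap. III n° 39 p. 189] -/
theorem continuous_toQuotFun₂_doubledLineThetaLift (Φ : piSchwartzBruhat (Fp L) (Fin n'')) :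
    Continuous (toQuotFun₂ (adelicGroupData (Fp L) L (IsCMField.complexConj L) N H)
      (fun g => doubledLineThetaLift L e dV hdV dW hdW e₁ hdV0 hdW0 lam hlam a' hρ μW Φ f (iotaV L e dV hdV dW hdW (ιA g.1, ιA g.2)))) := by
  haveI := compactSpace_quotient_range_toAdelic_JW L a'
  rw [show toQuotFun₂ (adelicGroupData (Fp L) L (IsCMField.complexConj L) N H)
      (fun g => doubledLineThetaLift L e dV hdV dW hdW e₁ hdV0 hdW0 lam hlam a' hρ μW Φ f (iotaV L e dV hdV dW hdW (ιA g.1, ιA g.2))) =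
      fun x => _ from funext (toQuotFun₂_doubledLineThetaLift_apply L e H dV hdV dW hdW e₁ hdV0 hdW0 lam hlam a' hρ ιA μW f Φ)]
  exact (continuous_integral_thetaKer (lineThetaKernelDatum L (n + n) e₁ (dD L e dV hdV dW hdW) (dD_conj L e dV hdV dW hdW)
      (dD_ne_zero L e dV hdV dW hdW hdV0 hdW0) lam hlam a' hρ) μW f Φ).comp
    (continuous_doubledThetaPoint L e H dV hdV dW hdW ιA hιAc hιAr)

include hιAc hιAr in
/-- **Uniform convergence of the socket's kernel along a linear family** (Weil's Théorème 6 in the `Φ`-variable): if `Λ : E → 𝒮(𝔸^{n″})` is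
`ℂ`-linear from a barrelled space `E` with continuous theta slots `e ↦ Θ(ω(s p)(Λ e))` (★ `continuous_toThetaTop_repWeilThetaDatum` turns this into
continuity for Weil's theta-initial topology, the carrier of ★ `lineThetaKernelDatum`), then for `ε > 0`, eventually as `e → e₀`,
`‖F (Λ e) x − F (Λ e₀) x‖ ≤ ε` for ALL `x ∈ [G]²` (§1 `thetaKer_integral_uniformOn` on the compact range of the point map; `[G]` compact).
[cite: HarrisKudlaSweet1996, §1 proof of Lem. 1.1] [cite: Weil1964, Chap. III n° 41, Thm 6 p. 193] -/
theorem toQuotFun₂_doubledLineThetaLift_uniform_of_slot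
    [CompactSpace (adelicGroupData (Fp L) L (IsCMField.complexConj L) N H).automorphicQuotient]
    {E : Type*} [AddCommGroup E] [Module ℂ E] [UniformSpace E] [IsUniformAddGroup E] [ContinuousSMul ℂ E] [BarrelledSpace ℂ E]
    (Λ : E →ₗ[ℂ] piSchwartzBruhat (Fp L) (Fin n''))
    (hΛ : ∀ p : ↥(UnitaryGroup.adelic (Fp L) L (IsCMField.complexConj L) (n + n) (Matrix.diagonal (dD L e dV hdV dW hdW))) ×
        ↥(UnitaryGroup.adelic (Fp L) L (IsCMField.complexConj L) 1 (JW (Fp L) L a')),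
      Continuous fun x => thetaDistLM (Fp L) (Fin n'')
        (pairRep (Fp L) L (IsCMField.complexConj L) (n + n) 1 e₁ (Matrix.diagonal (dD L e dV hdV dW hdW)) (JW (Fp L) L a')
          (chiSplittingLine L e₁ (dD L e dV hdV dW hdW) (dD_conj L e dV hdV dW hdW) (dD_ne_zero L e dV hdV dW hdW hdV0 hdW0)
            (toHeckeCharacter L lam) (isUnitary_toHeckeCharacter L lam)
            ((isOscillatorChar_toHeckeCharacter_iff lam).mpr hlam) (TW (Fp L) a')
            (isUnit_det_TW (Fp L) a') (JW (Fp L) L a') (JW_eq (Fp L) L a'))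
          p (Λ x)))
    (e₀ : E) {ε : ℝ} (hε : 0 < ε) :
    ∀ᶠ x' in 𝓝 e₀, ∀ x,
      ‖toQuotFun₂ (adelicGroupData (Fp L) L (IsCMField.complexConj L) N H)
          (fun g => doubledLineThetaLift L e dV hdV dW hdW e₁ hdV0 hdW0 lam hlam a' hρ μW (Λ x') f (iotaV L e dV hdV dW hdW (ιA g.1, ιA g.2))) x -
        toQuotFun₂ (adelicGroupData (Fp L) L (IsCMField.complexConj L) N H)
          (fun g => doubledLineThetaLift L e dV hdV dW hdW e₁ hdV0 hdW0 lam hlam a' hρ μW (Λ e₀) f (iotaV L e dV hdV dW hdW (ιA g.1, ιA g.2))) x‖ ≤ ε := by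
  haveI := compactSpace_quotient_range_toAdelic_JW L a'
  have hK := isCompact_range (continuous_doubledThetaPoint L e H dV hdV dW hdW ιA hιAc hιAr)
  have hc := continuous_toThetaTop_repWeilThetaDatum
    (pairRep (Fp L) L (IsCMField.complexConj L) (n + n) 1 e₁ (Matrix.diagonal (dD L e dV hdV dW hdW)) (JW (Fp L) L a')
      (chiSplittingLine L e₁ (dD L e dV hdV dW hdW) (dD_conj L e dV hdV dW hdW) (dD_ne_zero L e dV hdV dW hdW hdV0 hdW0)
        (toHeckeCharacter L lam) (isUnitary_toHeckeCharacter L lam)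
        ((isOscillatorChar_toHeckeCharacter_iff lam).mpr hlam) (TW (Fp L) a')
        (isUnit_det_TW (Fp L) a') (JW (Fp L) L a') (JW_eq (Fp L) L a'))).toHomUnits
    (((UnitaryGroup.toAdelic (Fp L) L (IsCMField.complexConj L) (n + n) (Matrix.diagonal (dD L e dV hdV dW hdW))).range.prod
        (UnitaryGroup.toAdelic (Fp L) L (IsCMField.complexConj L) 1 (JW (Fp L) L a')).range :
          Subgroup (↥(UnitaryGroup.adelic (Fp L) L (IsCMField.complexConj L) (n + n) (Matrix.diagonal (dD L e dV hdV dW hdW))) ×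
            ↥(UnitaryGroup.adelic (Fp L) L (IsCMField.complexConj L) 1 (JW (Fp L) L a')))) :
        Set (↥(UnitaryGroup.adelic (Fp L) L (IsCMField.complexConj L) (n + n) (Matrix.diagonal (dD L e dV hdV dW hdW))) ×
          ↥(UnitaryGroup.adelic (Fp L) L (IsCMField.complexConj L) 1 (JW (Fp L) L a'))))
    hρ Λ hΛ
  have hu := (hc.tendsto e₀).eventually (thetaKer_integral_uniformOn (lineThetaKernelDatum L (n + n) e₁ (dD L e dV hdV dW hdW)
    (dD_conj L e dV hdV dW hdW) (dD_ne_zero L e dV hdV dW hdW hdV0 hdW0) lam hlam a' hρ) μW f hK (Λ e₀) hε)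
  filter_upwards [hu] with x' hx' x
  rw [toQuotFun₂_doubledLineThetaLift_apply, toQuotFun₂_doubledLineThetaLift_apply]
  exact hx' _ (mem_range_self x)

include hιAc hιAr in
/-- **Continuity of the doubling pairing along a linear family** for the kernel `F Φ = toQuotFun₂ (g ↦ Θ̃_Φ(f)(ι(ιA g₁, ιA g₂)))`, `[G]` compact, `μ` any
measure on `[G]`, `w₁, w₂ ∈ L¹(μ)`: for `Λ : E → 𝒮(𝔸^{n″})` linear from a barrelled space with continuous theta slots,
`e ↦ doublingPairing μ (F (Λ e)) w₁ w₂` is continuous on `E` (★ `continuousAt_doublingPairing_of_uniform` fed by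
`toQuotFun₂_doubledLineThetaLift_uniform_of_slot`; continuity ⇒ a.e.-strong measurability on the second-countable `[G]²`; bound on the compact `[G]²`).
[cite: HarrisKudlaSweet1996, §1 proof of Lem. 1.1] [cite: Weil1964, Chap. III n° 41, Thm 6 p. 193] -/
theorem continuous_doublingPairing_doubledLineThetaLift_of_slot
    [CompactSpace (adelicGroupData (Fp L) L (IsCMField.complexConj L) N H).automorphicQuotient]
    (μ : Measure (adelicGroupData (Fp L) L (IsCMField.complexConj L) N H).automorphicQuotient)
    {w₁ w₂ : (adelicGroupData (Fp L) L (IsCMField.complexConj L) N H).automorphicQuotient → ℂ}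
    (hw₁ : Integrable w₁ μ) (hw₂ : Integrable w₂ μ)
    {E : Type*} [AddCommGroup E] [Module ℂ E] [UniformSpace E] [IsUniformAddGroup E] [ContinuousSMul ℂ E] [BarrelledSpace ℂ E]
    (Λ : E →ₗ[ℂ] piSchwartzBruhat (Fp L) (Fin n''))
    (hΛ : ∀ p : ↥(UnitaryGroup.adelic (Fp L) L (IsCMField.complexConj L) (n + n) (Matrix.diagonal (dD L e dV hdV dW hdW))) ×
        ↥(UnitaryGroup.adelic (Fp L) L (IsCMField.complexConj L) 1 (JW (Fp L) L a')),
      Continuous fun x => thetaDistLM (Fp L) (Fin n'')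
        (pairRep (Fp L) L (IsCMField.complexConj L) (n + n) 1 e₁ (Matrix.diagonal (dD L e dV hdV dW hdW)) (JW (Fp L) L a')
          (chiSplittingLine L e₁ (dD L e dV hdV dW hdW) (dD_conj L e dV hdV dW hdW) (dD_ne_zero L e dV hdV dW hdW hdV0 hdW0)
            (toHeckeCharacter L lam) (isUnitary_toHeckeCharacter L lam)
            ((isOscillatorChar_toHeckeCharacter_iff lam).mpr hlam) (TW (Fp L) a')
            (isUnit_det_TW (Fp L) a') (JW (Fp L) L a') (JW_eq (Fp L) L a'))
          p (Λ x))) :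
    Continuous fun x : E =>
      doublingPairing (adelicGroupData (Fp L) L (IsCMField.complexConj L) N H) μ
        (toQuotFun₂ (adelicGroupData (Fp L) L (IsCMField.complexConj L) N H)
          (fun g => doubledLineThetaLift L e dV hdV dW hdW e₁ hdV0 hdW0 lam hlam a' hρ μW (Λ x) f (iotaV L e dV hdV dW hdW (ιA g.1, ιA g.2))))
        w₁ w₂ := by
  haveI : SecondCountableTopology (adelicGroupData (Fp L) L (IsCMField.complexConj L) N H).Adelic :=
    secondCountableTopology_cmDatum_Adelic L N H
  haveI : SecondCountableTopology (adelicGroupData (Fp L) L (IsCMField.complexConj L) N H).automorphicQuotient :=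
    inferInstanceAs (SecondCountableTopology ((adelicGroupData (Fp L) L (IsCMField.complexConj L) N H).Adelic ⧸
      (adelicGroupData (Fp L) L (IsCMField.complexConj L) N H).quotientSubgroup))
  refine continuous_iff_continuousAt.2 fun e₀ => ?_
  have hcont := fun Φ => continuous_toQuotFun₂_doubledLineThetaLift L e H dV hdV dW hdW e₁ hdV0 hdW0 lam hlam a' hρ ιA hιAc hιAr μW f Φ
  obtain ⟨C, hC⟩ := (isCompact_univ.image (hcont (Λ e₀))).isBounded.exists_norm_le
  refine continuousAt_doublingPairing_of_uniform (adelicGroupData (Fp L) L (IsCMField.complexConj L) N H) μ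
    (fun x : E => toQuotFun₂ (adelicGroupData (Fp L) L (IsCMField.complexConj L) N H)
      (fun g => doubledLineThetaLift L e dV hdV dW hdW e₁ hdV0 hdW0 lam hlam a' hρ μW (Λ x) f (iotaV L e dV hdV dW hdW (ιA g.1, ιA g.2))))
    e₀ (hcont (Λ e₀)).aestronglyMeasurable (C := C) (fun x => hC _ (mem_image_of_mem _ (mem_univ x))) (fun ε hε => ?_) hw₁ hw₂
  filter_upwards [toQuotFun₂_doubledLineThetaLift_uniform_of_slot L e H dV hdV dW hdW e₁ hdV0 hdW0 lam hlam a' hρ ιA hιAc hιAr μW f Λ hΛ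
    e₀ hε] with x' hx'
  exact ⟨(hcont (Λ x')).aestronglyMeasurable, hx'⟩

include hιAc hιAr in
/-- **THE ARCHIMEDEAN SLOT OF THE #44∕45 HYPOTHESIS KERNEL IS CONTINUOUS** (`f = 1`, ★ `doubledLineThetaIntegral = doubledLineThetaLift … 1`): for a fixed
finite part `Φ_f`, `[G]` compact, any measure `μ` on `[G]`, `w₁, w₂ ∈ L¹(μ)`,
**`φ ↦ doublingPairing μ (toQuotFun₂ (g ↦ I(ι(ιA g₁, ιA g₂); φ ⊗ Φ_f, μW))) w₁ w₂` is continuous on the Schwartz space `𝓢(X_∞)`**, `X_∞ = (L⁺ ⊗ ℝ)^{n″}`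
(every `ω(s p)` is LF-continuous, ★ `adelicMpCont.isLFContinuous_omega`, so the slots are continuous, ★ `continuous_thetaDistLM_comp_tmul_of_isLFContinuous`;
`𝓢(X_∞)` is barrelled, ★ `barrelledSpace_schwartzMap`) — organ (O45)(i) of socket #44∕45: with (O45)(ii) (density of `𝓢(X_∞′) ⊗ 𝓢(X_∞′)` in `𝓢(X_∞)`,
the finite part being algebraically a sum of pure tensors) it moves the non-vanishing hypothesis to a pure tensor `Φ′ = Φ₁ ⊗ Φ₂`.
[cite: HarrisKudlaSweet1996, §1 proof of Lem. 1.1] [cite: Weil1964, Chap. I n° 11 pp. 157–158; Chap. III n° 41, Thm 6 p. 193] [cite: Liu2021, App. B (B.7), Lem. B.11] -/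
theorem continuous_doublingPairing_doubledLineThetaIntegral_tmul
    [CompactSpace (adelicGroupData (Fp L) L (IsCMField.complexConj L) N H).automorphicQuotient]
    (μ : Measure (adelicGroupData (Fp L) L (IsCMField.complexConj L) N H).automorphicQuotient)
    {w₁ w₂ : (adelicGroupData (Fp L) L (IsCMField.complexConj L) N H).automorphicQuotient → ℂ}
    (hw₁ : Integrable w₁ μ) (hw₂ : Integrable w₂ μ) (Φf : FinSB (↥(maximalRealSubfield L)) (Fin n'')) :
    Continuous fun φ : 𝓢((Fin n'' → mixedEmbedding.mixedSpace ↥(maximalRealSubfield L)), ℂ) =>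
      doublingPairing (adelicGroupData (Fp L) L (IsCMField.complexConj L) N H) μ
        (toQuotFun₂ (adelicGroupData (Fp L) L (IsCMField.complexConj L) N H)
          (fun g => doubledLineThetaIntegral L e dV hdV dW hdW e₁ hdV0 hdW0 lam hlam a' hρ μW
            (piSchwartzBruhatEquiv (↥(maximalRealSubfield L)) (Fin n'') (φ ⊗ₜ[ℂ] Φf)) (iotaV L e dV hdV dW hdW (ιA g.1, ιA g.2))))
        w₁ w₂ := by
  haveI : BarrelledSpace ℂ 𝓢((Fin n'' → mixedEmbedding.mixedSpace ↥(maximalRealSubfield L)), ℂ) :=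
    Literature.Analysis.FunctionSpaces.barrelledSpace_schwartzMap
  have h := continuous_doublingPairing_doubledLineThetaLift_of_slot L e H dV hdV dW hdW e₁ hdV0 hdW0 lam hlam a' hρ ιA hιAc hιAr μW 1 μ
    hw₁ hw₂ ((piSchwartzBruhatEquiv (↥(maximalRealSubfield L)) (Fin n'')).toLinearMap ∘ₗ
      (TensorProduct.mk ℂ 𝓢((Fin n'' → mixedEmbedding.mixedSpace ↥(maximalRealSubfield L)), ℂ)
        (FinSB (↥(maximalRealSubfield L)) (Fin n''))).flip Φf)
    fun p => continuous_thetaDistLM_comp_tmul_of_isLFContinuous (adelicMpCont.isLFContinuous_omega _) Φf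
  exact h.congr fun φ => rfl

end Socket

end Summit.HodgeConjecture.HodgeConjecture.Cruxes.HLiu418.K2LiuDoubledThetaPairingContinuous

end
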